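import Summits.AtomisticToContinuum.FouriersLaw.Theses.ContactEchoEpochs

/-!
# Birth skeleton (`Lines/birth.lean`) for crux `ContactKubo` (stmt-AtomisticToContinuum-11822)

Route `ContactEchoEpochs` (sub-problem `FouriersLaw`), crux r5 `ContactKubo` = the CONTACT FORM OF THE
FINITE-VOLUME KUBO FORMULA: for `P = pinnedChain ω₂ lam β γ` (all four `> 0`), ASSUMING weak-NESS uniqueness,
for every `T > 0` and every `n` (chain of `N = n + 2` sites `0 … n+1`, both baths at `T`):
(i) the contact echo `c_N(t) = ∫ w_L · (P_t w_R) dμ_T`, `w_L = γ(T - p_0²)`, `w_R = γ(T - p_{n+1}²)`,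
`P_t = P.transitionKernel (n+2) T T t⁺` (the CONSTRUCTED Langevin kernels), `μ_T = P.gibbsMeasure (n+2) T`,
is integrable on `(0, ∞)`; (ii) along EVERY steady-state family `μ`,
`totalCurrent(μ (n+2) (T+δ/2) (T-δ/2))/δ → (n+1)·T⁻²·∫_{t>0} c_N(t)` as `δ → 0`, `δ ≠ 0`.

## The line: REDUCTION TO THE LANDED CROSS-FORM BOUNDARY KUBO IDENTITY (three stubs)

Write `C_M(t) := ∫ p_0²·(K_t p_M²) dμ_T - (∫ p_0² dμ_T)(∫ K_t p_M² dμ_T)` for the momentum-power covariance of the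
`(M+1)`-site chain (`K_t = P.transitionKernel (M+1) T T t⁺`, `μ_T = P.gibbsMeasure (M+1) T`).

* `stub_crossKubo` — the fixed-size CROSS-FORM boundary Kubo limit for the `(M+1)`-site chain under weak-NESS
  uniqueness, along any steady family: `totalCurrent(μ (M+1) (T+δ/2) (T-δ/2))/δ → M·(γ²/T²)·∫_{t>0} C_M(t)`.
  This is, verbatim, clause 2 of the sibling crux `PhononMeanFreePath.BoundaryKubo`
  (stmt-AtomisticToContinuum-11812), which is LANDED: `Theorems/PhononMeanFreePathBoundaryKubo.lean`,
  `PhononMeanFreePathBoundaryKubo.boundaryKubo_proof` (line `gibbs-ttcf`: Gibbs-tested TTCF identity, locally uniform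
  Harris in the bath temperatures, energy balance, equilibrium sum rule — i.e. exactly the content (a)(b)(c) the crux
  docstring asks for, with CEHR's Harris structure in place of Hairer–Majda). Discharge:
  `fun … hU μ hμ T hT M => (boundaryKubo_proof … hU μ hμ T hT M).2` (import that Theorems file; nothing else).
* `stub_covIntegrable` — `C_M ∈ L¹(0, ∞)` at EVERY size, with NO uniqueness / steady-family hypothesis
  (exponential mixing of the equal-temperature chain at fixed size, CEHR Thm 2.13(3) via Harris). Needed as a
  separate stub because the crux states integrability BEFORE the steady-family binder whereas `BoundaryKubo` states
  it after. LANDED verbatim: `IncoherentBounded.CN_integrableOn`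
  (`Theorems/PhononMeanFreePathIncoherentBoundedCorrelationDecay.lean`); discharge
  `fun … hω hl hβ hγ T hT M => IncoherentBounded.CN_integrableOn hω hl.le hβ hγ hT M`.
* `stub_contactEcho` — CONTACT POWERS VERSUS MOMENTUM POWERS, pointwise in `t` (kernel at `t⁺`):
  `c_{n+2}(t) = γ² · C_{n+1}(t)`. Expanding `w_L · K_t w_R = γ²(T - p_0²)(T - K_t p_{n+1}²)` (Markov kernels,
  `p_{n+1}²` integrable under every `K_t(z,·)` by the exponential moments along the constructed kernels) the left side
  is `γ² ∫ (p_0² - T)·K_t(p_{n+1}² - T) dμ_T`, and the centred kernel equals the uncentred covariance `C_{n+1}(t)` by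
  equipartition `∫ p_0² dμ_T = T` + Gibbs invariance (LANDED: `IncoherentBounded.CN_eq_kinCorr`,
  `Theorems/PhononMeanFreePathIncoherentBoundedFixedN.lean`). Size S/M: ~30 lines over those two lemmas and
  `pinnedChain_isMarkovKernel_transitionKernel`.
* `ContactKubo_of` — the composition, kernel-checked here (no `sorry`): rewrite the crux's integrand on `(0,∞)` by
  `stub_contactEcho`; integrability is `γ² • stub_covIntegrable` at `M := n+1`; the limit is `stub_crossKubo` at
  `M := n+1` (`n+1+1 = n+2` definitionally) with the value algebra `(n+1)·T⁻²·(γ²∫C) = (n+1)·(γ²/T²)·∫C`.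

Hardest stub: `stub_contactEcho` (the only one not landed verbatim; S/M, pure Gibbs/kernel bookkeeping with all
ingredients in tree). CONSEQUENCE: the crux `ContactKubo` is PROVABLE NOW — a prover re-files this composition in
`Theorems/ContactEchoEpochsContactKubo.lean` importing the two `PhononMeanFreePath*` Theorems files, discharging
stubs 1–2 by the one-liners above and stub 3 by the ~30-line computation.

## Disproof used
No `Cruxes/ContactKubo/Disproof.lean` exists (`ledger crux ls stmt-AtomisticToContinuum-11822`: no workfiles before
this one). The sibling's negative file `Theorems/BoundaryKubo/Negative/LoadBearing.lean` applies verbatim to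
`stub_crossKubo` and is honoured: `limitClause_false_without_steady`, `limitClause_false_without_T_pos` (the steady
family and `T > 0` are load-bearing — both are carried by `stub_crossKubo` AND by the crux), `body_vacuous_gamma_zero`
(`γ > 0` enters through uniqueness; the crux has `0 < γ`). `ledger negatives --problem AtomisticToContinuum` (20
entries): the only `FouriersLaw` ones are `not_OddCorrectorDecay` (stmt-9139, an `N`-UNIFORM integrability bound —
`stub_covIntegrable` is per-`N`, constants free to degrade with `N`) and `FarFieldGaussianity_refuted` (stmt-12890,
unrelated); nothing refutes a fixed-`N` Kubo identity, and no landed Negative lemma refutes an instance of any stub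
(stubs 1–2 are theorems; stub 3 is an identity between finite Gibbs integrals, checked numerically in the harmonic
corner by the gen-1 planner / refuter audit of the crux: `J̃/δ = T⁻²∫c_N` to 6 digits).
-/

noncomputable section

open MeasureTheory Filter Topology Set
open scoped NNReal

namespace Summit.AtomisticToContinuum.FouriersLaw.Cruxes.ContactKubo.Birth

open Literature.MathematicalPhysics.KineticTheory.HeatConduction
open Summit.AtomisticToContinuum.FouriersLaw.Theses.ContactEchoEpochs (ContactKubo)

/-! ### The registered stubs (`sorry` lives ONLY here) -/

/-- STUB 1 `stub_crossKubo` (size: landed; was L) — the CROSS-FORM BOUNDARY KUBO LIMIT for the `(M+1)`-site chain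
under weak-NESS uniqueness, along any steady-state family: `totalCurrent(μ (M+1) (T+δ/2) (T-δ/2))/δ →
M·(γ²/T²)·∫_{t>0} C_M(t)` with `C_M(t) = μ_T(p_0²·K_t p_M²) - μ_T(p_0²)·μ_T(K_t p_M²)`. Verbatim clause 2 of
`PhononMeanFreePath.BoundaryKubo` (stmt-AtomisticToContinuum-11812), proved in
`Theorems/PhononMeanFreePathBoundaryKubo.lean` (`boundaryKubo_proof`). [cite: KunduDharNarayan2009]
[cite: CuneoEckmannHairerReyBellet2018, Thm 2.13] -/
theorem stub_crossKubo :
    ∀ ω₂ lam β γ : ℝ, 0 < ω₂ → 0 < lam → 0 < β → 0 < γ →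
      (∀ (N : ℕ) (T_L T_R : ℝ), 0 < T_L → 0 < T_R → ∀ μ ν : Measure (PhaseSpace N),
          (pinnedChain ω₂ lam β γ).IsSteadyState N T_L T_R μ →
            (pinnedChain ω₂ lam β γ).IsSteadyState N T_L T_R ν → μ = ν) →
        ∀ μ : (N : ℕ) → ℝ → ℝ → Measure (PhaseSpace N),
          (∀ (N : ℕ) (T_L T_R : ℝ), 0 < T_L → 0 < T_R →
              (pinnedChain ω₂ lam β γ).IsSteadyState N T_L T_R (μ N T_L T_R)) →
            ∀ T : ℝ, 0 < T → ∀ M : ℕ,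
              Tendsto (fun δ : ℝ =>
                  (pinnedChain ω₂ lam β γ).totalCurrent (μ (M + 1) (T + δ / 2) (T - δ / 2)) / δ)
                (𝓝[≠] 0)
                (𝓝 ((M : ℝ) * (γ ^ 2 / T ^ 2) * ∫ t in Ioi (0 : ℝ),
                  ((∫ z, (z.2 0) ^ 2 * (∫ y, (y.2 (Fin.last M)) ^ 2
                      ∂((pinnedChain ω₂ lam β γ).transitionKernel (M + 1) T T t.toNNReal z))
                      ∂((pinnedChain ω₂ lam β γ).gibbsMeasure (M + 1) T)) -
                    (∫ z, (z.2 0) ^ 2 ∂((pinnedChain ω₂ lam β γ).gibbsMeasure (M + 1) T)) *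
                      (∫ z, (∫ y, (y.2 (Fin.last M)) ^ 2
                        ∂((pinnedChain ω₂ lam β γ).transitionKernel (M + 1) T T t.toNNReal z))
                        ∂((pinnedChain ω₂ lam β γ).gibbsMeasure (M + 1) T))))) := by
  sorry

/-- STUB 2 `stub_covIntegrable` (size: landed; was L) — FIXED-SIZE INTEGRABILITY OF THE KUBO INTEGRAND, with no
uniqueness or steady-family hypothesis: for the `(M+1)`-site chain at temperature `T > 0`,
`t ↦ C_M(t) = μ_T(p_0²·K_t p_M²) - μ_T(p_0²)·μ_T(K_t p_M²)` is integrable on `(0, ∞)` (exponential mixing at fixed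
size; the constants may degrade with `M`). Verbatim `IncoherentBounded.CN_integrableOn`
(`Theorems/PhononMeanFreePathIncoherentBoundedCorrelationDecay.lean`).
[cite: CuneoEckmannHairerReyBellet2018, Thm 2.13 (3)] -/
theorem stub_covIntegrable :
    ∀ ω₂ lam β γ : ℝ, 0 < ω₂ → 0 < lam → 0 < β → 0 < γ → ∀ T : ℝ, 0 < T → ∀ M : ℕ,
      IntegrableOn (fun t : ℝ =>
          (∫ z, (z.2 0) ^ 2 * (∫ y, (y.2 (Fin.last M)) ^ 2
              ∂((pinnedChain ω₂ lam β γ).transitionKernel (M + 1) T T t.toNNReal z))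
              ∂((pinnedChain ω₂ lam β γ).gibbsMeasure (M + 1) T)) -
            (∫ z, (z.2 0) ^ 2 ∂((pinnedChain ω₂ lam β γ).gibbsMeasure (M + 1) T)) *
              (∫ z, (∫ y, (y.2 (Fin.last M)) ^ 2
                ∂((pinnedChain ω₂ lam β γ).transitionKernel (M + 1) T T t.toNNReal z))
                ∂((pinnedChain ω₂ lam β γ).gibbsMeasure (M + 1) T)))
        (Ioi 0) := by
  sorry

/-- STUB 3 `stub_contactEcho` (size S/M) — CONTACT POWERS VERSUS MOMENTUM POWERS, pointwise in `t` (kernel at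
`t⁺`): for the `(n+2)`-site chain at `T > 0`, the contact echo `∫ γ(T - p_0²)·K_t(γ(T - p_{n+1}²)) dμ_T` equals
`γ² · C_{n+1}(t)`, `C_{n+1}(t) = μ_T(p_0²·K_t p_{n+1}²) - μ_T(p_0²)·μ_T(K_t p_{n+1}²)`. Why true:
`K_t(γ(T - p²))(z) = γ(T - K_t p²(z))` (Markov kernel `pinnedChain_isMarkovKernel_transitionKernel`, `p_{n+1}²`
integrable under `K_t(z,·)` by the exponential kernel moments), so the left side is `γ² ∫ (p_0² - T)·K_t(p_{n+1}² - T)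
dμ_T`, which is `γ² · C_{n+1}(t)` by the landed centring identity `IncoherentBounded.CN_eq_kinCorr` (equipartition
`μ_T(p_0²) = T`, Gibbs invariance). [folklore] -/
theorem stub_contactEcho :
    ∀ ω₂ lam β γ : ℝ, 0 < ω₂ → 0 < lam → 0 < β → 0 < γ → ∀ T : ℝ, 0 < T → ∀ (n : ℕ) (t : ℝ),
      (∫ z, γ * (T - (z.2 0) ^ 2) * (∫ y, γ * (T - (y.2 (Fin.last (n + 1))) ^ 2)
          ∂((pinnedChain ω₂ lam β γ).transitionKernel (n + 2) T T (Real.toNNReal t) z))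
          ∂((pinnedChain ω₂ lam β γ).gibbsMeasure (n + 2) T)) =
        γ ^ 2 *
          ((∫ z, (z.2 0) ^ 2 * (∫ y, (y.2 (Fin.last (n + 1))) ^ 2
              ∂((pinnedChain ω₂ lam β γ).transitionKernel (n + 2) T T t.toNNReal z))
              ∂((pinnedChain ω₂ lam β γ).gibbsMeasure (n + 2) T)) -
            (∫ z, (z.2 0) ^ 2 ∂((pinnedChain ω₂ lam β γ).gibbsMeasure (n + 2) T)) *
              (∫ z, (∫ y, (y.2 (Fin.last (n + 1))) ^ 2
                ∂((pinnedChain ω₂ lam β γ).transitionKernel (n + 2) T T t.toNNReal z))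
                ∂((pinnedChain ω₂ lam β γ).gibbsMeasure (n + 2) T))) := by
  sorry

/-! ### By-name statements of the registered stubs

The skeleton audit wants the hypotheses of the crux-concluding theorem to be the declared stubs BY NAME;
`Registered.stub_x` is DEFINITIONALLY the statement of the sorried `theorem stub_x` (`type_of%`), so
`ContactKubo_of : Registered.stub_crossKubo → Registered.stub_covIntegrable → Registered.stub_contactEcho →
ContactKubo` is literally "stub signatures → crux", and the `example` at the end type-checks
`ContactKubo_of stub_crossKubo stub_covIntegrable stub_contactEcho : ContactKubo`. -/

namespace Registered

/-- Statement of registered stub 1 (`stub_crossKubo`), by name. -/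
def stub_crossKubo : Prop := type_of% Birth.stub_crossKubo

/-- Statement of registered stub 2 (`stub_covIntegrable`), by name. -/
def stub_covIntegrable : Prop := type_of% Birth.stub_covIntegrable

/-- Statement of registered stub 3 (`stub_contactEcho`), by name. -/
def stub_contactEcho : Prop := type_of% Birth.stub_contactEcho

end Registered

/-! ### The composition (kernel-checked, no `sorry`): the three stubs give the crux BY NAME -/

/-- `stub_crossKubo → stub_covIntegrable → stub_contactEcho → ContactKubo`: at `N = n + 2` sites rewrite the
contact echo on `(0, ∞)` as `γ² · C_{n+1}` (stub 3); integrability is `γ² • (stub 2 at M := n+1)`; the response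
limit along any steady family is stub 1 at `M := n+1` (`n+1+1 = n+2` definitionally), with the value algebra
`(n+1)·T⁻²·(γ² ∫ C_{n+1}) = (n+1)·(γ²/T²)·∫ C_{n+1}`. [folklore] -/
theorem ContactKubo_of (h1 : Registered.stub_crossKubo) (h2 : Registered.stub_covIntegrable)
    (h3 : Registered.stub_contactEcho) : ContactKubo := by
  intro ω₂ lam β γ hω hl hβ hγ hU T hT n
  -- stub 3: the two integrands agree pointwise in `t` (as functions of `t`)
  have hcf : (fun t : ℝ => ∫ z, γ * (T - (z.2 0) ^ 2) * (∫ y, γ * (T - (y.2 (Fin.last (n + 1))) ^ 2)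
          ∂((pinnedChain ω₂ lam β γ).transitionKernel (n + 2) T T (Real.toNNReal t) z))
          ∂((pinnedChain ω₂ lam β γ).gibbsMeasure (n + 2) T)) =
      fun t : ℝ => γ ^ 2 *
          ((∫ z, (z.2 0) ^ 2 * (∫ y, (y.2 (Fin.last (n + 1))) ^ 2
              ∂((pinnedChain ω₂ lam β γ).transitionKernel (n + 2) T T t.toNNReal z))
              ∂((pinnedChain ω₂ lam β γ).gibbsMeasure (n + 2) T)) -
            (∫ z, (z.2 0) ^ 2 ∂((pinnedChain ω₂ lam β γ).gibbsMeasure (n + 2) T)) *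
              (∫ z, (∫ y, (y.2 (Fin.last (n + 1))) ^ 2
                ∂((pinnedChain ω₂ lam β γ).transitionKernel (n + 2) T T t.toNNReal z))
                ∂((pinnedChain ω₂ lam β γ).gibbsMeasure (n + 2) T))) :=
    funext fun t => h3 ω₂ lam β γ hω hl hβ hγ T hT n t
  -- stub 2 at `M := n + 1`: the momentum-power covariance of the `(n+2)`-chain is integrable on `(0, ∞)`
  have hI : IntegrableOn (fun t : ℝ =>
        (∫ z, (z.2 0) ^ 2 * (∫ y, (y.2 (Fin.last (n + 1))) ^ 2
            ∂((pinnedChain ω₂ lam β γ).transitionKernel (n + 2) T T t.toNNReal z))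
            ∂((pinnedChain ω₂ lam β γ).gibbsMeasure (n + 2) T)) -
          (∫ z, (z.2 0) ^ 2 ∂((pinnedChain ω₂ lam β γ).gibbsMeasure (n + 2) T)) *
            (∫ z, (∫ y, (y.2 (Fin.last (n + 1))) ^ 2
              ∂((pinnedChain ω₂ lam β γ).transitionKernel (n + 2) T T t.toNNReal z))
              ∂((pinnedChain ω₂ lam β γ).gibbsMeasure (n + 2) T))) (Ioi 0) :=
    h2 ω₂ lam β γ hω hl hβ hγ T hT (n + 1)
  refine ⟨?_, fun μ hμ => ?_⟩
  · -- clause (i): integrability of the contact echo on `(0, ∞)`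
    rw [hcf]
    exact hI.const_mul (γ ^ 2)
  · -- clause (ii): the response limit along the steady family `μ` is stub 1 at `M := n + 1`
    have hlim := h1 ω₂ lam β γ hω hl hβ hγ hU μ hμ T hT (n + 1)
    rw [hcf, integral_const_mul]
    convert hlim using 2
    push_cast
    ring

/-- Type-check (not a declaration): the sorried stubs are literally the antecedents of `ContactKubo_of`
(conditional on the stubs; an `example`, so it adds nothing to the environment). -/
example : ContactKubo := ContactKubo_of stub_crossKubo stub_covIntegrable stub_contactEcho

end Summit.AtomisticToContinuum.FouriersLaw.Cruxes.ContactKubo.Birth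

end
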